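import Mathlib
import HarnessLib
import Literature.NumberTheory.LFunctions.CriticalLineTwoThirds
import Literature.NumberTheory.LFunctions.CriticalLineTwoThirdsProofs
import Literature.NumberTheory.LFunctions.CriticalLineTwoThirdsInertia
import Literature.NumberTheory.LFunctions.MontgomeryTaylorConstantNumerics
import Literature.NumberTheory.LFunctions.SelbergFujiiGapMoment

/-!
# RH-FREE — «nothing here bears on the truth of RH»: Alpöge–Furman 2026 §6, the finite-dimensional certificate behind Theorem A for SIMPLE zeros (`P₁`, `Q′`) PROVED, and the web of implications among the typed claims (Montgomery–Taylor ⇒ flat window, rate ⇒ dyadic ⇒ cumulative) PROVED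

Topic `Literature/NumberTheory/LFunctions` (namespace `Literature.NumberTheory.LFunctions`; helper
lemmas in the sub-namespace `AlpogeFurman2026.SimpleCert`). PROOF LAYER, theorems only (no
definitions, no named facts), cell `rh-columns/lit` (tranche 1, unit `rh-lit-frontier-1` gen 4), for
the statement file `CriticalLineTwoThirds.lean`:

* [AF26] L. Alpöge, R. Furman, *More than two thirds of the zeros of the Riemann zeta function are
  simple and on the critical line*, arXiv:2608.13637v2 (19 Aug 2026; no later version on
  2026-08-27), UNREFEREED. TeX of record
  `run/shared/lean/pub/rh-crit/ah/src/AlpogeFurman2026_arXiv2608.13637v2.tex`, §6 "Proofs of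
  Theorems A and B" (TeX l. 553–567 = PDF p. 12), Theorem A (p. 1), Remark 6.1 (p. 12).

## What the source prints (§6, proof of Theorem A, p. 12 — VERBATIM up to notation)

"Set `P₁ := (aL²)⁻¹ Σ_{ρ ∈ on₁} v_ρ v_ρᵀ` (the simple on-line zeros) and `Q′ := G̃ − P₁`. Then
`P₁ ⪰ 0`, `rank P₁ ≤ s₁`, `tr P₁ ≤ s₁` (Lemma 2.1, each `m_ρ = 1`); and `Q′` is the pull-back of
`⊕_{ρ ∈ on_{≥2}} m_ρ|x|² ⊕ ⊕_{pairs} (0 m_ρ; m_ρ 0)`, so `n₊(Q′) ≤ s₂ + p` by Lemma 3.1. Lemma 3.2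
with `(P₁, Q′)` and `tr Q′ = tr G̃ − tr P₁` gives
`rank P₁ ≥ 2 tr P₁ + 4(tr G̃ − tr P₁) − 4(s₂ + p) − ‖G̃‖²_HS = 4 tr G̃ − 2 tr P₁ − 4(s₂ + p) − ‖G̃‖²_HS`,
and since `tr P₁ + 2(s₂ + p) ≤ s₁ + 2s₂ + 2p ≤ N(I′)` this is `≥ 4 tr G̃ − 2N(I′) − ‖G̃‖²_HS`. …
For (ii): rearranging the display above, `3s₁ + 4(s₂ + p) ≥ 4 tr G̃ − ‖G̃‖²_HS`; subtracting
`s₁ + 2s₂ + 2p ≤ N(I′)` gives `2(s₁ + s₂ + p) ≥ (3 − R(ψ) − o(1))N`, and `N_d(I′) ≥ s₁ + s₂ + p`.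
The cumulative form follows by summing over dyadic windows."
Here `s₁` = number of simple on-line zeros with `Re γ_ρ ∈ I′`, `s₂` = number of DISTINCT on-line
zeros of multiplicity `≥ 2` there, `p` = number of off-line pairs `{ρ, 1 − ρ̄}` there, and in the
pull-back description an on-line zero of multiplicity `m_ρ ≥ 2` contributes the rank-one block
`m_ρ v_ρ v_ρᵀ` (`v_ρ` real), an off-line pair the signature-`(1,1)` block
`m_ρ (v_ρ v_ρᵀ + v̄_ρ v̄_ρᵀ) = 2m_ρ (a aᵀ − b bᵀ)`, `v_ρ = a + ib` (Proposition 4.1, p. 6).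

## What is proved here (0 definitions, 0 facts)

§1 (matrix level, any dimension `d`, the finite-dimensional skeleton of §6 — the analytic inputs
`tr G̃ = N(I′) + o(N)` (Prop. 4.2) and `‖G̃‖²_HS = (R(ψ) + o(1))N` (Thm. 5.7) are NOT touched,
D-0040):
* `AlpogeFurman2026_mixed_blocks` — **`n₊(Q′) ≤ s₂ + p`**: for
  `Q′ = Σ_{j ∈ ι₂} μ_j w_j w_jᴴ + Σ_{k ∈ κ} m_k (a_k a_kᴴ − b_k b_kᴴ)` with `m_k ≥ 0` (the `μ_j` may
  have any sign), `n₊(Q′) ≤ #ι₂ + #κ` (the form is `≤ 0` on `⋂_j ker w_jᴴ ∩ ⋂_k ker a_kᴴ`, of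
  codimension `≤ #ι₂ + #κ`; Sylvester in the complement form
  `AlpogeFurman2026.Inertia.posEigenvalueCount_add_finrank_le` of `CriticalLineTwoThirdsInertia.lean`
  — the tree's rendering of the paper's appeal to Lemma 3.1);
* `AlpogeFurman2026_simple_block_certificate` — **the §6 display**: with
  `P₁ = Σ_{j ∈ ι₁} μ_j v_j v_jᴴ`, `μ_j ≥ 0`,
  `#ι₁ ≥ 2 tr P₁ + 4 tr Q′ − 4(#ι₂ + #κ) − ‖P₁ + Q′‖²_HS` (Lemma 3.2 = the tree theorem
  `AlpogeFurman2026_rank_trace_holds`, fed with `rank P₁ ≤ #ι₁`, `P₁ ⪰ 0`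
  (`AlpogeFurman2026.onLine_rank_le` / `onLine_posSemidef`) and the bound above);
* `AlpogeFurman2026_simple_block_certificate_trace` — the same regrouped with `G̃ = P₁ + Q′`:
  `#ι₁ ≥ 4 tr G̃ − 2 tr P₁ − 4(#ι₂ + #κ) − ‖G̃‖²_HS`;
* `AlpogeFurman2026_simple_chain_i` — the next printed step: if `tr P₁ + 2(#ι₂ + #κ) ≤ N′` then
  `#ι₁ ≥ 4 tr G̃ − 2N′ − ‖G̃‖²_HS` (in [AF26] `N′ = N(I′)`);
* `AlpogeFurman2026_simple_chain_ii` — the (ii) rearrangement: if `tr P₁ ≤ #ι₁` then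
  `3#ι₁ + 4(#ι₂ + #κ) ≥ 4 tr G̃ − ‖G̃‖²_HS`, and with `#ι₁ + 2#ι₂ + 2#κ ≤ N′`,
  `2(#ι₁ + #ι₂ + #κ) ≥ 4 tr G̃ − ‖G̃‖²_HS − N′`.
With these, `CriticalLineTwoThirdsInertia.lean` (Lemma 3.1, Proposition 4.1's blocks, Corollary 4.4's
certificate `AlpogeFurman2026_block_certificate`) and `CriticalLineTwoThirdsProofs.lean` (Lemma 3.2,
Lemma 5.6), every finite-dimensional step of [AF26] §§3, 4.1, 6 is a kernel theorem; what remains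
of Theorem A are the two asymptotic evaluations (Proposition 4.2, Theorem 5.7) and the counting
bookkeeping `s₁ + 2s₂ + 2p ≤ N(I′) = N(I) + O(√T log T)`.

§2 (the claims of `CriticalLineTwoThirds.lean` form a DAG with three roots for `ζ`): PROVED
* `AlpogeFurman2026_simple_critical_dyadic_of_MT`, `AlpogeFurman2026_distinct_dyadic_of_MT` — the
  Montgomery–Taylor claims (constants `2 − R(ψ_MT) = 0.67250…`, `½(3 − R(ψ_MT)) = 0.83625…`) imply
  the flat-window claims (`2/3`, `5/6`), by the kernel numerics
  `montgomeryTaylorInvConstant_bounds` (`MontgomeryTaylorConstantNumerics.lean`: `R(ψ_MT) < 1.3275`);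
* `AlpogeFurman2026_simple_critical_dyadic_of_rate` — Remark 6.1's rate form implies Theorem A (i)
  dyadic (`log log T / log T → 0`);
* `AlpogeFurman2026_simple_critical_of_MT`, `AlpogeFurman2026_distinct_of_MT`,
  `AlpogeFurman2026_simple_critical_of_rate` — hence the cumulative claims (through the tree's
  `AlpogeFurman2026_simple_critical_of_dyadic` / `_distinct_of_dyadic`, `CriticalLineTwoThirdsProofs.lean`).
So of the seven `ζ`-claims of the statement file only `_simple_critical_MT_dyadic`,
`_distinct_MT_dyadic`, `_simple_critical_rate` are independent; Theorem B
(`_dirichlet_*_dyadic`) and Remark 7.1 (`_xiDeriv_simple_critical_dyadic`) are separate.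

## Status note (no endorsement)

[AF26] is an unrefereed preprint (arXiv v2 of 19 Aug 2026 is still the latest on 2026-08-27; no
journal reference, no DOI). Nothing in this file asserts any of its analytic statements: §1 is linear
algebra over `ℂ^d` for arbitrary finite families of vectors, §2 is implications between the typed
claims. Nothing here bears on the truth of RH.

## References

* [AF26] as above, §6 (p. 12), Theorem A (p. 1), Remark 6.1 (p. 12), Proposition 4.1 (p. 6),
  Lemma 3.2 (p. 5). [key `AlpogeFurman2026`]
-/

open Matrix Complex Finset Module Filter
open scoped ComplexOrder Topology Real

namespace Literature.NumberTheory.LFunctions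

/-! ## §1. The finite-dimensional certificate of [AF26] §6 (simple zeros) -/

namespace AlpogeFurman2026.SimpleCert

variable {n : Type*} [Fintype n]

/-- The rank-one form: `xᴴ (a aᴴ) x = |aᴴ x|²`. [folklore] -/
private theorem form_rankOne (a x : n → ℂ) :
    star x ⬝ᵥ (vecMulVec a (star a) *ᵥ x) = ((‖star a ⬝ᵥ x‖ ^ 2 : ℝ) : ℂ) := by
  rw [vecMulVec_mulVec, IsCentralScalar.op_smul_eq_smul, dotProduct_smul, star_dotProduct x a,
    smul_eq_mul, Complex.star_def, Complex.mul_conj', Complex.ofReal_pow]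

/-- The Hermitian form of `Σ_j μ_j w_j w_jᴴ` is `Σ_j μ_j |w_jᴴ x|²`. [folklore] -/
private theorem form_onLine {ι : Type*} [Fintype ι] (μ : ι → ℝ) (w : ι → n → ℂ) (x : n → ℂ) :
    star x ⬝ᵥ ((∑ j, μ j • vecMulVec (w j) (star (w j))) *ᵥ x) =
      ((∑ j, μ j * ‖star (w j) ⬝ᵥ x‖ ^ 2 : ℝ) : ℂ) := by
  rw [sum_mulVec, dotProduct_sum, Complex.ofReal_sum]
  refine Finset.sum_congr rfl fun j _ ↦ ?_
  rw [smul_mulVec, dotProduct_smul, form_rankOne, Complex.real_smul]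
  push_cast
  ring

/-- The Hermitian form of `Σ_k m_k (a_k a_kᴴ − b_k b_kᴴ)` is `Σ_k m_k (|a_kᴴ x|² − |b_kᴴ x|²)`.
[folklore] -/
private theorem form_blocks {κ : Type*} [Fintype κ] (m : κ → ℝ) (a b : κ → n → ℂ) (x : n → ℂ) :
    star x ⬝ᵥ ((∑ k, m k • (vecMulVec (a k) (star (a k)) - vecMulVec (b k) (star (b k)))) *ᵥ x) =
      ((∑ k, m k * (‖star (a k) ⬝ᵥ x‖ ^ 2 - ‖star (b k) ⬝ᵥ x‖ ^ 2) : ℝ) : ℂ) := by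
  rw [sum_mulVec, dotProduct_sum, Complex.ofReal_sum]
  refine Finset.sum_congr rfl fun k _ ↦ ?_
  rw [smul_mulVec, dotProduct_smul, sub_mulVec, dotProduct_sub, form_rankOne, form_rankOne,
    Complex.real_smul]
  push_cast
  ring

end AlpogeFurman2026.SimpleCert

/-- The matrix `Q′ = Σ_j μ_j w_j w_jᴴ + Σ_k m_k (a_k a_kᴴ − b_k b_kᴴ)` (real weights) is Hermitian
(in [AF26] §6: `Q′ = G̃ − P₁`, the on-line zeros of multiplicity `≥ 2` and the off-line pairs).
[cite: AlpogeFurman2026, §6 proof of Theorem A (p. 12)] -/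
theorem AlpogeFurman2026.mixedBlocks_isHermitian {d ι κ : Type*} [Fintype ι] [Fintype κ]
    (μ : ι → ℝ) (w : ι → d → ℂ) (m : κ → ℝ) (a b : κ → d → ℂ) :
    ((∑ j, μ j • vecMulVec (w j) (star (w j))) +
      ∑ k, m k • (vecMulVec (a k) (star (a k)) - vecMulVec (b k) (star (b k)))).IsHermitian := by
  have h1 : ∀ v : d → ℂ, (vecMulVec v (star v))ᴴ = vecMulVec v (star v) := fun v ↦ by
    ext i j
    simp [vecMulVec_apply, conjTranspose_apply, mul_comm]
  refine Matrix.IsHermitian.add ?_ (AlpogeFurman2026.offlineBlocks_isHermitian m a b)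
  unfold Matrix.IsHermitian
  rw [conjTranspose_sum]
  refine Finset.sum_congr rfl fun j _ ↦ ?_
  rw [conjTranspose_smul, h1, star_trivial]

open AlpogeFurman2026.SimpleCert AlpogeFurman2026.Inertia in
/-- **[AF26] §6, proof of Theorem A: `n₊(Q′) ≤ s₂ + p`.** For
`Q′ = Σ_{j ∈ ι₂} μ_j w_j w_jᴴ + Σ_{k ∈ κ} m_k (a_k a_kᴴ − b_k b_kᴴ)` with `m_k ≥ 0` (any real `μ_j`),
the positive index satisfies `n₊(Q′) ≤ #ι₂ + #κ`: on `K = ⋂_j ker(w_jᴴ ·) ∩ ⋂_k ker(a_kᴴ ·)` the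
form is `−Σ_k m_k |b_kᴴ x|² ≤ 0`, and `codim K ≤ #ι₂ + #κ`. In the paper `ι₂ = on_{≥2}` (distinct
on-line zeros of multiplicity `≥ 2`, blocks `m_ρ v_ρ v_ρᵀ`), `κ` = the off-line pairs, and the bound
is read off Lemma 3.1 ("`Q′` is the pull-back of `⊕ m_ρ|x|² ⊕ ⊕ (0 m_ρ; m_ρ 0)`, so
`n₊(Q′) ≤ s₂ + p`"). [cite: AlpogeFurman2026, §6 proof of Theorem A (p. 12), with Lemma 3.1 (p. 5)] -/
theorem AlpogeFurman2026_mixed_blocks {d ι κ : Type*} [Fintype d] [DecidableEq d] [Fintype ι]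
    [Fintype κ] (μ : ι → ℝ) (w : ι → d → ℂ) (m : κ → ℝ) (hm : ∀ k, 0 ≤ m k) (a b : κ → d → ℂ)
    (hQ : ((∑ j, μ j • vecMulVec (w j) (star (w j))) +
      ∑ k, m k • (vecMulVec (a k) (star (a k)) - vecMulVec (b k) (star (b k)))).IsHermitian) :
    posEigenvalueCount hQ ≤ Fintype.card ι + Fintype.card κ := by
  classical
  -- the map `x ↦ ((w_jᴴ x)_j, (a_kᴴ x)_k)`
  let φ : (d → ℂ) →ₗ[ℂ] (ι ⊕ κ → ℂ) :=
    { toFun := fun x ↦ Sum.elim (fun j ↦ star (w j) ⬝ᵥ x) (fun k ↦ star (a k) ⬝ᵥ x)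
      map_add' := fun x y ↦ by
        funext s
        cases s <;> simp [dotProduct_add]
      map_smul' := fun c x ↦ by
        funext s
        cases s <;> simp [dotProduct_smul] }
  -- on its kernel the form is `≤ 0`
  have hK : ∀ x ∈ LinearMap.ker φ, (star x ⬝ᵥ (((∑ j, μ j • vecMulVec (w j) (star (w j))) +
      ∑ k, m k • (vecMulVec (a k) (star (a k)) - vecMulVec (b k) (star (b k)))) *ᵥ x)).re ≤ 0 := by
    intro x hx
    rw [LinearMap.mem_ker] at hx
    have hw : ∀ j, star (w j) ⬝ᵥ x = 0 := fun j ↦ by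
      have := congrFun hx (Sum.inl j)
      simpa [φ] using this
    have ha : ∀ k, star (a k) ⬝ᵥ x = 0 := fun k ↦ by
      have := congrFun hx (Sum.inr k)
      simpa [φ] using this
    rw [add_mulVec, dotProduct_add, form_onLine, form_blocks, Complex.add_re, Complex.ofReal_re,
      Complex.ofReal_re]
    have h1 : ∑ j, μ j * ‖star (w j) ⬝ᵥ x‖ ^ 2 = 0 := by
      refine Finset.sum_eq_zero fun j _ ↦ ?_
      rw [hw j, norm_zero, zero_pow two_ne_zero, mul_zero]
    have h2 : ∑ k, m k * (‖star (a k) ⬝ᵥ x‖ ^ 2 - ‖star (b k) ⬝ᵥ x‖ ^ 2) ≤ 0 := by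
      refine Finset.sum_nonpos fun k _ ↦ mul_nonpos_of_nonneg_of_nonpos (hm k) ?_
      rw [ha k, norm_zero, zero_pow two_ne_zero, zero_sub, neg_nonpos]
      positivity
    linarith
  have h1 := posEigenvalueCount_add_finrank_le hQ (LinearMap.ker φ) hK
  have h2 := φ.finrank_range_add_finrank_ker
  have h3 : finrank ℂ (LinearMap.range φ) ≤ Fintype.card ι + Fintype.card κ := by
    calc finrank ℂ (LinearMap.range φ) ≤ finrank ℂ (ι ⊕ κ → ℂ) := Submodule.finrank_le _
      _ = Fintype.card (ι ⊕ κ) := Module.finrank_fintype_fun_eq_card ℂ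
      _ = Fintype.card ι + Fintype.card κ := Fintype.card_sum
  rw [Module.finrank_fintype_fun_eq_card] at h2
  omega

open AlpogeFurman2026 in
/-- **[AF26] §6, proof of Theorem A — the displayed certificate for simple zeros.** For on-line
simple-zero data `(μ_j ≥ 0, v_j)_{j ∈ ι₁}`, on-line multiple-zero data `(μ′_j, w_j)_{j ∈ ι₂}` and
off-line pair data `(m_k ≥ 0, a_k, b_k)_{k ∈ κ}` in `ℂ^d`, with `P₁ = Σ_j μ_j v_j v_jᴴ` and
`Q′ = Σ_j μ′_j w_j w_jᴴ + Σ_k m_k (a_k a_kᴴ − b_k b_kᴴ)`: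
`#ι₁ ≥ 2 tr P₁ + 4 tr Q′ − 4(#ι₂ + #κ) − ‖P₁ + Q′‖²_HS` ("Lemma 3.2 with `(P₁, Q′)`": `P₁ ⪰ 0`,
`rank P₁ ≤ s₁ = #ι₁`, `n₊(Q′) ≤ s₂ + p = #ι₂ + #κ`). Traces through `re`, `‖R‖²_HS = tr R²`.
[cite: AlpogeFurman2026, §6 proof of Theorem A (p. 12), with Lemma 3.2 (p. 5)] -/
theorem AlpogeFurman2026_simple_block_certificate (d : ℕ) {ι₁ ι₂ κ : Type*} [Fintype ι₁]
    [Fintype ι₂] [Fintype κ] (μ : ι₁ → ℝ) (hμ : ∀ j, 0 ≤ μ j) (v : ι₁ → Fin d → ℂ)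
    (μ' : ι₂ → ℝ) (w : ι₂ → Fin d → ℂ) (m : κ → ℝ) (hm : ∀ k, 0 ≤ m k) (a b : κ → Fin d → ℂ)
    (P₁ Q' : Matrix (Fin d) (Fin d) ℂ) (hP : P₁ = ∑ j, μ j • vecMulVec (v j) (star (v j)))
    (hQ : Q' = (∑ j, μ' j • vecMulVec (w j) (star (w j))) +
      ∑ k, m k • (vecMulVec (a k) (star (a k)) - vecMulVec (b k) (star (b k)))) :
    2 * (P₁.trace).re + 4 * (Q'.trace).re - 4 * ((Fintype.card ι₂ : ℝ) + Fintype.card κ) -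
      (((P₁ + Q') * (P₁ + Q')).trace).re ≤ (Fintype.card ι₁ : ℝ) := by
  subst hP hQ
  have h := AlpogeFurman2026_rank_trace_holds d _ _ (onLine_posSemidef μ hμ v)
    (mixedBlocks_isHermitian μ' w m a b) (Fintype.card ι₁) (Fintype.card ι₂ + Fintype.card κ)
    (onLine_rank_le μ v) (AlpogeFurman2026_mixed_blocks μ' w m hm a b _)
  push_cast at h
  linarith

/-- **[AF26] §6, the certificate regrouped with `G̃ = P₁ + Q′`** ("… and `tr Q′ = tr G̃ − tr P₁`
gives `rank P₁ ≥ 4 tr G̃ − 2 tr P₁ − 4(s₂ + p) − ‖G̃‖²_HS`"): under the hypotheses of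
`AlpogeFurman2026_simple_block_certificate`,
`#ι₁ ≥ 4 tr G̃ − 2 tr P₁ − 4(#ι₂ + #κ) − ‖G̃‖²_HS`.
[cite: AlpogeFurman2026, §6 proof of Theorem A (p. 12)] -/
theorem AlpogeFurman2026_simple_block_certificate_trace (d : ℕ) {ι₁ ι₂ κ : Type*} [Fintype ι₁]
    [Fintype ι₂] [Fintype κ] (μ : ι₁ → ℝ) (hμ : ∀ j, 0 ≤ μ j) (v : ι₁ → Fin d → ℂ)
    (μ' : ι₂ → ℝ) (w : ι₂ → Fin d → ℂ) (m : κ → ℝ) (hm : ∀ k, 0 ≤ m k) (a b : κ → Fin d → ℂ)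
    (P₁ Q' G : Matrix (Fin d) (Fin d) ℂ) (hP : P₁ = ∑ j, μ j • vecMulVec (v j) (star (v j)))
    (hQ : Q' = (∑ j, μ' j • vecMulVec (w j) (star (w j))) +
      ∑ k, m k • (vecMulVec (a k) (star (a k)) - vecMulVec (b k) (star (b k))))
    (hG : G = P₁ + Q') :
    4 * (G.trace).re - 2 * (P₁.trace).re - 4 * ((Fintype.card ι₂ : ℝ) + Fintype.card κ) -
      ((G * G).trace).re ≤ (Fintype.card ι₁ : ℝ) := by
  have h := AlpogeFurman2026_simple_block_certificate d μ hμ v μ' w m hm a b P₁ Q' hP hQ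
  subst hG
  rw [trace_add, Complex.add_re]
  linarith

/-- **[AF26] §6, Theorem A (i), the next printed step** ("since `tr P₁ + 2(s₂ + p) ≤ s₁ + 2s₂ + 2p
≤ N(I′)` this is `≥ 4 tr G̃ − 2N(I′) − ‖G̃‖²_HS`"): if `tr P₁ + 2(#ι₂ + #κ) ≤ N′` then
`#ι₁ ≥ 4 tr G̃ − 2N′ − ‖G̃‖²_HS`. (In the paper `N′ = N(I′)`; then `tr G̃ = N(I′) + o(N)`
(Proposition 4.2) and `‖G̃‖²_HS = (R(ψ) + o(1))N` (Theorem 5.7) — NOT part of this theorem — give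
`N₀^s ≥ s₁ − O(√T log T) ≥ (2 − R(ψ) − o(1))N`.)
[cite: AlpogeFurman2026, §6 proof of Theorem A (p. 12)] -/
theorem AlpogeFurman2026_simple_chain_i (d : ℕ) {ι₁ ι₂ κ : Type*} [Fintype ι₁]
    [Fintype ι₂] [Fintype κ] (μ : ι₁ → ℝ) (hμ : ∀ j, 0 ≤ μ j) (v : ι₁ → Fin d → ℂ)
    (μ' : ι₂ → ℝ) (w : ι₂ → Fin d → ℂ) (m : κ → ℝ) (hm : ∀ k, 0 ≤ m k) (a b : κ → Fin d → ℂ)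
    (P₁ Q' G : Matrix (Fin d) (Fin d) ℂ) (hP : P₁ = ∑ j, μ j • vecMulVec (v j) (star (v j)))
    (hQ : Q' = (∑ j, μ' j • vecMulVec (w j) (star (w j))) +
      ∑ k, m k • (vecMulVec (a k) (star (a k)) - vecMulVec (b k) (star (b k))))
    (hG : G = P₁ + Q') {N' : ℝ}
    (hN : (P₁.trace).re + 2 * ((Fintype.card ι₂ : ℝ) + Fintype.card κ) ≤ N') :
    4 * (G.trace).re - 2 * N' - ((G * G).trace).re ≤ (Fintype.card ι₁ : ℝ) := by
  have h := AlpogeFurman2026_simple_block_certificate_trace d μ hμ v μ' w m hm a b P₁ Q' G hP hQ hG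
  linarith

/-- **[AF26] §6, Theorem A (ii), the rearrangement** ("rearranging the display above,
`3s₁ + 4(s₂ + p) ≥ 4 tr G̃ − ‖G̃‖²_HS`; subtracting `s₁ + 2s₂ + 2p ≤ N(I′)` gives
`2(s₁ + s₂ + p) ≥ (3 − R(ψ) − o(1))N`"): if `tr P₁ ≤ #ι₁` (in the paper: Lemma 2.1, `m_ρ = 1`) then
`3#ι₁ + 4(#ι₂ + #κ) ≥ 4 tr G̃ − ‖G̃‖²_HS`, and if moreover `#ι₁ + 2#ι₂ + 2#κ ≤ N′` then
`2(#ι₁ + #ι₂ + #κ) ≥ 4 tr G̃ − ‖G̃‖²_HS − N′`. (Then `N_d(I′) ≥ s₁ + s₂ + p` and the two asymptotic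
inputs — not part of this theorem — give (ii).) [cite: AlpogeFurman2026, §6 proof of Theorem A (p. 12)] -/
theorem AlpogeFurman2026_simple_chain_ii (d : ℕ) {ι₁ ι₂ κ : Type*} [Fintype ι₁]
    [Fintype ι₂] [Fintype κ] (μ : ι₁ → ℝ) (hμ : ∀ j, 0 ≤ μ j) (v : ι₁ → Fin d → ℂ)
    (μ' : ι₂ → ℝ) (w : ι₂ → Fin d → ℂ) (m : κ → ℝ) (hm : ∀ k, 0 ≤ m k) (a b : κ → Fin d → ℂ)
    (P₁ Q' G : Matrix (Fin d) (Fin d) ℂ) (hP : P₁ = ∑ j, μ j • vecMulVec (v j) (star (v j)))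
    (hQ : Q' = (∑ j, μ' j • vecMulVec (w j) (star (w j))) +
      ∑ k, m k • (vecMulVec (a k) (star (a k)) - vecMulVec (b k) (star (b k))))
    (hG : G = P₁ + Q') (htr : (P₁.trace).re ≤ Fintype.card ι₁) :
    4 * (G.trace).re - ((G * G).trace).re ≤
        3 * (Fintype.card ι₁ : ℝ) + 4 * ((Fintype.card ι₂ : ℝ) + Fintype.card κ) ∧
      ∀ N' : ℝ, (Fintype.card ι₁ : ℝ) + 2 * Fintype.card ι₂ + 2 * Fintype.card κ ≤ N' →
        4 * (G.trace).re - ((G * G).trace).re - N' ≤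
          2 * ((Fintype.card ι₁ : ℝ) + Fintype.card ι₂ + Fintype.card κ) := by
  have h := AlpogeFurman2026_simple_block_certificate_trace d μ hμ v μ' w m hm a b P₁ Q' G hP hQ hG
  refine ⟨by linarith, fun N' hN' ↦ by linarith⟩

/-! ## §2. The web of implications among the typed claims of `CriticalLineTwoThirds.lean` -/

/-- **[AF26] Theorem A: the Montgomery–Taylor constant beats the flat one, simple zeros**
("the constants improve to `2 − c_MT⁻¹ = 0.67250…`", p. 1), PROVED as an implication between the
typed claims: `AlpogeFurman2026_simple_critical_MT_dyadic → AlpogeFurman2026_simple_critical_dyadic`,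
because `2/3 < 0.6725 < 2 − R(ψ_MT)` (`montgomeryTaylorInvConstant_bounds`) and `N(T,2T) ≥ 0`.
[cite: AlpogeFurman2026, Theorem A (p. 1)] -/
theorem AlpogeFurman2026_simple_critical_dyadic_of_MT (h : AlpogeFurman2026_simple_critical_MT_dyadic) :
    AlpogeFurman2026_simple_critical_dyadic := by
  intro ε hε
  have hR := montgomeryTaylorInvConstant_bounds.2
  filter_upwards [h ε hε, eventually_ge_atTop (0 : ℝ)] with T hT hT0
  have hN : (zetaZeroCount T : ℝ) ≤ zetaZeroCount (2 * T) := by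
    exact_mod_cast zetaZeroCount_mono (by linarith)
  nlinarith

/-- **[AF26] Theorem A: the Montgomery–Taylor constant beats the flat one, distinct zeros**
("`½(3 − c_MT⁻¹) = 0.83625…`", p. 1), PROVED:
`AlpogeFurman2026_distinct_MT_dyadic → AlpogeFurman2026_distinct_dyadic` (`5/6 < 0.83625 < ½(3 − R(ψ_MT))`).
[cite: AlpogeFurman2026, Theorem A (p. 1)] -/
theorem AlpogeFurman2026_distinct_dyadic_of_MT (h : AlpogeFurman2026_distinct_MT_dyadic) :
    AlpogeFurman2026_distinct_dyadic := by
  intro ε hε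
  have hR := montgomeryTaylorInvConstant_bounds.2
  filter_upwards [h ε hε, eventually_ge_atTop (0 : ℝ)] with T hT hT0
  have hN : (zetaZeroCount T : ℝ) ≤ zetaZeroCount (2 * T) := by
    exact_mod_cast zetaZeroCount_mono (by linarith)
  nlinarith

/-- Hence the Montgomery–Taylor simple-zero claim implies Theorem A (i) in cumulative form
(`_simple_critical_MT_dyadic → _simple_critical`, through `AlpogeFurman2026_simple_critical_of_dyadic`).
[cite: AlpogeFurman2026, Theorem A (p. 1–2) and §6 (p. 12)] -/
theorem AlpogeFurman2026_simple_critical_of_MT (h : AlpogeFurman2026_simple_critical_MT_dyadic) :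
    AlpogeFurman2026_simple_critical :=
  AlpogeFurman2026_simple_critical_of_dyadic (AlpogeFurman2026_simple_critical_dyadic_of_MT h)

/-- Hence the Montgomery–Taylor distinct-zero claim implies Theorem A (ii) in cumulative form
(`_distinct_MT_dyadic → _distinct`). [cite: AlpogeFurman2026, Theorem A (p. 1–2) and §6 (p. 12)] -/
theorem AlpogeFurman2026_distinct_of_MT (h : AlpogeFurman2026_distinct_MT_dyadic) :
    AlpogeFurman2026_distinct :=
  AlpogeFurman2026_distinct_of_dyadic (AlpogeFurman2026_distinct_dyadic_of_MT h)

/-- `log log T / log T → 0` as `T → ∞` (the rate of [AF26] Remark 6.1 is `o(1)`). [folklore] -/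
private theorem AlpogeFurman2026.SimpleCert.tendsto_loglog_div_log :
    Tendsto (fun T : ℝ ↦ Real.log (Real.log T) / Real.log T) atTop (𝓝 0) := by
  have h := (Real.tendsto_pow_log_div_mul_add_atTop 1 0 1 one_ne_zero).comp Real.tendsto_log_atTop
  refine h.congr' (Eventually.of_forall fun T ↦ ?_)
  simp [Function.comp]

/-- **[AF26] Remark 6.1 ⇒ Theorem A (i), dyadic form**, PROVED as an implication between the typed
claims: `AlpogeFurman2026_simple_critical_rate → AlpogeFurman2026_simple_critical_dyadic` (for every
`ε > 0`, eventually `c log log T / log T ≤ ε`, whatever the sign of `c`, and `N(T,2T) ≥ 0`).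
[cite: AlpogeFurman2026, Remark 6.1 (p. 12) and Theorem A (p. 1)] -/
theorem AlpogeFurman2026_simple_critical_dyadic_of_rate (h : AlpogeFurman2026_simple_critical_rate) :
    AlpogeFurman2026_simple_critical_dyadic := by
  intro ε hε
  obtain ⟨c, T₀, hT₀⟩ := h
  have hc : Tendsto (fun T : ℝ ↦ c * (Real.log (Real.log T) / Real.log T)) atTop (𝓝 0) := by
    simpa using AlpogeFurman2026.SimpleCert.tendsto_loglog_div_log.const_mul c
  have hev : ∀ᶠ T : ℝ in atTop, c * (Real.log (Real.log T) / Real.log T) ≤ ε :=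
    (hc.eventually (eventually_le_nhds hε)).mono fun T hT ↦ hT
  filter_upwards [hev, eventually_ge_atTop T₀, eventually_ge_atTop (0 : ℝ)] with T hT hT₀' hT0
  have h1 := hT₀ T hT₀'
  have hN : (zetaZeroCount T : ℝ) ≤ zetaZeroCount (2 * T) := by
    exact_mod_cast zetaZeroCount_mono (by linarith)
  have h2 : c * Real.log (Real.log T) / Real.log T = c * (Real.log (Real.log T) / Real.log T) := by
    ring
  rw [h2] at h1
  nlinarith

/-- Hence Remark 6.1's rate form implies Theorem A (i) in cumulative form
(`_simple_critical_rate → _simple_critical`). [cite: AlpogeFurman2026, Remark 6.1 (p. 12), Theorem A (p. 1–2)] -/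
theorem AlpogeFurman2026_simple_critical_of_rate (h : AlpogeFurman2026_simple_critical_rate) :
    AlpogeFurman2026_simple_critical :=
  AlpogeFurman2026_simple_critical_of_dyadic (AlpogeFurman2026_simple_critical_dyadic_of_rate h)

end Literature.NumberTheory.LFunctions

/-!
## §3. Theorem A (i) on `(0, T)` WITH THE RATE `O(log log T / log T)` (p. 2), from Remark 6.1

(Appended by cell `rh-columns/lit`, unit `rh-lit-frontier-1` gen 4; RH-FREE — nothing here bears on
the truth of RH.) [AF26] p. 2, after Theorem A: "The same holds for `(0,T)` in place of `(T,2T)`,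
with rate `O(log log T/ log T)` (Remark 6.1)." The statement file types the `o(1)` cumulative form
(`AlpogeFurman2026_simple_critical`) and Remark 6.1's DYADIC rate form
(`AlpogeFurman2026_simple_critical_rate`); here the CUMULATIVE RATE form is PROVED from the latter:
`AlpogeFurman2026_simple_critical_rate.cumulative` — there are `c′, T₀′` with
`(2/3 − c′ log log T / log T) N(T) ≤ N₀^s(T)` for all `T ≥ T₀′`. Route ("summing over dyadic
windows", §6): telescoping over `T/2, T/4, …` down to a fixed `[T₁, 2T₁)`, the block at `t` losing
`|c| (log log t/log t) N(t,2t) ≤ 4C|c| t log log T` by the tree's `N(u) ≤ C u log u`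
(`AH.exists_zetaZeroCount_le_mul_log`, Riemann–von Mangoldt), the blocks' `t` summing to `≤ T`, and
`T log log T ≤ 4π (log log T/log T) N(T)` by the tree's `N(T) ≥ T log T/(4π)`
(`SelbergFujii.exists_mul_log_le_zetaZeroCount`); the boundary term `(2/3)N(2T₁)` is absorbed the
same way.
-/

namespace Literature.NumberTheory.LFunctions

namespace AlpogeFurman2026.SimpleCert

/-- `1 ≤ log t` for `t ≥ e`. [folklore] -/
private theorem one_le_log {t : ℝ} (ht : Real.exp 1 ≤ t) : 1 ≤ Real.log t := by
  rw [← Real.log_exp 1]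
  exact Real.log_le_log (Real.exp_pos 1) ht

/-- `log log` is monotone on `[e, ∞)`. [folklore] -/
private theorem loglog_mono {s t : ℝ} (hs : Real.exp 1 ≤ s) (hst : s ≤ t) :
    Real.log (Real.log s) ≤ Real.log (Real.log t) := by
  have hs0 : 0 < s := (Real.exp_pos 1).trans_le hs
  have h1 := one_le_log hs
  exact Real.log_le_log (by linarith) (Real.log_le_log hs0 hst)

/-- The loss on one dyadic block: for `e ≤ t`, `2 ≤ t ≤ T` and `N(u) ≤ C u log u` (`u ≥ 2`),
`(log log t/log t) · N(t,2t) ≤ 4C t log log T`. [cite: AlpogeFurman2026, §6 proof of Theorem A (p. 12), "summing over dyadic windows"] -/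
private theorem block_loss {C : ℝ} (hC0 : 0 ≤ C)
    (hC : ∀ u : ℝ, 2 ≤ u → (zetaZeroCount u : ℝ) ≤ C * (u * Real.log u))
    {t T : ℝ} (hte : Real.exp 1 ≤ t) (ht2 : 2 ≤ t) (htT : t ≤ T) :
    Real.log (Real.log t) / Real.log t * ((zetaZeroCount (2 * t) : ℝ) - zetaZeroCount t) ≤
      4 * C * t * Real.log (Real.log T) := by
  have ht0 : 0 < t := by linarith
  have hlogt := one_le_log hte
  have hlogt0 : 0 < Real.log t := by linarith
  have hr0 : 0 ≤ Real.log (Real.log t) / Real.log t :=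
    div_nonneg (Real.log_nonneg hlogt) hlogt0.le
  have hN : (zetaZeroCount (2 * t) : ℝ) - zetaZeroCount t ≤ C * (2 * t * (2 * Real.log t)) := by
    have h1 := hC (2 * t) (by linarith)
    have h2 : Real.log (2 * t) ≤ 2 * Real.log t := by
      rw [Real.log_mul two_ne_zero ht0.ne']
      have : Real.log 2 ≤ Real.log t := Real.log_le_log two_pos ht2
      linarith
    have h0 : (0 : ℝ) ≤ zetaZeroCount t := Nat.cast_nonneg _
    calc (zetaZeroCount (2 * t) : ℝ) - zetaZeroCount t ≤ zetaZeroCount (2 * t) := by linarith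
      _ ≤ C * (2 * t * Real.log (2 * t)) := h1
      _ ≤ C * (2 * t * (2 * Real.log t)) := by gcongr
  have hll : Real.log (Real.log t) ≤ Real.log (Real.log T) := loglog_mono hte htT
  have h4 : 0 ≤ 4 * C * t := by positivity
  calc Real.log (Real.log t) / Real.log t * ((zetaZeroCount (2 * t) : ℝ) - zetaZeroCount t)
      ≤ Real.log (Real.log t) / Real.log t * (C * (2 * t * (2 * Real.log t))) := by gcongr
    _ = 4 * C * t * Real.log (Real.log t) := by
        field_simp
        ring
    _ ≤ 4 * C * t * Real.log (Real.log T) := by gcongr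

/-- Telescoping WITH the rate: if `(2/3 − c₁ log log t/log t) N(t,2t) ≤ N₀^s(t,2t)` for `t ≥ T₁`
(`T₁ ≥ e`, `T₁ ≥ 2`, `c₁ ≥ 0`) and `N(u) ≤ C u log u`, then for `T₁ ≤ T ≤ 2^{n+1} T₁`,
`(2/3)(N(T) − N(2T₁)) − 4C c₁ T log log T ≤ N₀^s(T)`.
[cite: AlpogeFurman2026, §6 proof of Theorem A (p. 12), "summing over dyadic windows"] -/
private theorem telescope_rate {C c₁ T₁ : ℝ} (hC0 : 0 ≤ C)
    (hC : ∀ u : ℝ, 2 ≤ u → (zetaZeroCount u : ℝ) ≤ C * (u * Real.log u))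
    (hc₁ : 0 ≤ c₁) (hT₁e : Real.exp 1 ≤ T₁) (hT₁2 : 2 ≤ T₁)
    (h : ∀ t : ℝ, T₁ ≤ t →
      (2 / 3 - c₁ * (Real.log (Real.log t) / Real.log t)) *
          ((zetaZeroCount (2 * t) : ℝ) - zetaZeroCount t) ≤
        (simpleCriticalZeroCount (2 * t) : ℝ) - simpleCriticalZeroCount t) :
    ∀ n : ℕ, ∀ T : ℝ, T₁ ≤ T → T ≤ 2 ^ (n + 1) * T₁ →
      2 / 3 * ((zetaZeroCount T : ℝ) - zetaZeroCount (2 * T₁)) -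
          4 * C * c₁ * T * Real.log (Real.log T) ≤
        simpleCriticalZeroCount T := by
  intro n
  induction n with
  | zero =>
    intro T h1 h2
    have hN : (zetaZeroCount T : ℝ) ≤ zetaZeroCount (2 * T₁) := by
      exact_mod_cast zetaZeroCount_mono (by simpa using h2)
    have hS : (0 : ℝ) ≤ simpleCriticalZeroCount T := Nat.cast_nonneg _
    have hll : 0 ≤ Real.log (Real.log T) := Real.log_nonneg (one_le_log (hT₁e.trans h1))
    have hT0 : 0 ≤ T := by linarith
    have : 0 ≤ 4 * C * c₁ * T * Real.log (Real.log T) := by positivity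
    linarith
  | succ n ih =>
    intro T h1 h2
    by_cases hle : T ≤ 2 ^ (n + 1) * T₁
    · exact ih T h1 hle
    · push Not at hle
      have h2pow : (2 : ℝ) ≤ 2 ^ (n + 1) := by
        calc (2 : ℝ) = 2 ^ 1 := by norm_num
          _ ≤ 2 ^ (n + 1) := pow_le_pow_right₀ (by norm_num) (by omega)
      have h3 : T₁ ≤ T / 2 := by nlinarith
      have h4 : T / 2 ≤ 2 ^ (n + 1) * T₁ := by
        rw [pow_succ] at h2
        linarith
      have hih := ih (T / 2) h3 h4
      have hstep := h (T / 2) h3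
      have hte : Real.exp 1 ≤ T / 2 := hT₁e.trans h3
      have ht2 : 2 ≤ T / 2 := hT₁2.trans h3
      have htT : T / 2 ≤ T := by linarith
      have hblock := block_loss hC0 hC hte ht2 htT
      have hll : Real.log (Real.log (T / 2)) ≤ Real.log (Real.log T) := loglog_mono hte htT
      have hTc : 0 ≤ 4 * C * c₁ * (T / 2) := by positivity
      have hm : 4 * C * c₁ * (T / 2) * Real.log (Real.log (T / 2)) ≤
          4 * C * c₁ * (T / 2) * Real.log (Real.log T) := mul_le_mul_of_nonneg_left hll hTc
      rw [show 2 * (T / 2) = T by ring] at hstep hblock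
      -- the block inequality, expanded
      have hexp : 2 / 3 * ((zetaZeroCount T : ℝ) - zetaZeroCount (T / 2)) -
          c₁ * (Real.log (Real.log (T / 2)) / Real.log (T / 2) *
            ((zetaZeroCount T : ℝ) - zetaZeroCount (T / 2))) ≤
          (simpleCriticalZeroCount T : ℝ) - simpleCriticalZeroCount (T / 2) := by
        have : (2 / 3 - c₁ * (Real.log (Real.log (T / 2)) / Real.log (T / 2))) *
            ((zetaZeroCount T : ℝ) - zetaZeroCount (T / 2)) =
            2 / 3 * ((zetaZeroCount T : ℝ) - zetaZeroCount (T / 2)) -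
              c₁ * (Real.log (Real.log (T / 2)) / Real.log (T / 2) *
                ((zetaZeroCount T : ℝ) - zetaZeroCount (T / 2))) := by ring
        rw [this] at hstep
        exact hstep
      have hcb : c₁ * (Real.log (Real.log (T / 2)) / Real.log (T / 2) *
          ((zetaZeroCount T : ℝ) - zetaZeroCount (T / 2))) ≤
          c₁ * (4 * C * (T / 2) * Real.log (Real.log T)) := mul_le_mul_of_nonneg_left hblock hc₁
      linarith

end AlpogeFurman2026.SimpleCert

open AlpogeFurman2026.SimpleCert in
/-- **[AF26] Theorem A (i) on `(0,T)` with the rate `O(log log T/log T)`** (p. 2: "The same holds for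
`(0,T)` in place of `(T,2T)`, with rate `O(log log T/ log T)` (Remark 6.1)"), PROVED from the typed
dyadic rate claim `AlpogeFurman2026_simple_critical_rate` (Remark 6.1, flat window): there are
`c′, T₀′` with `(2/3 − c′ log log T/log T) N(T) ≤ N₀^s(T)` for all `T ≥ T₀′`. Inputs beyond the
claim: the tree's Riemann–von Mangoldt bounds `N(u) ≤ C u log u` (`AH.exists_zetaZeroCount_le_mul_log`)
and `N(T) ≥ T log T/(4π)` (`SelbergFujii.exists_mul_log_le_zetaZeroCount`).
[cite: AlpogeFurman2026, p. 2 (sentence after Theorem A) and Remark 6.1 (p. 12)] -/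
theorem AlpogeFurman2026_simple_critical_rate.cumulative (h : AlpogeFurman2026_simple_critical_rate) :
    ∃ c T₀ : ℝ, ∀ T : ℝ, T₀ ≤ T →
      (2 / 3 - c * Real.log (Real.log T) / Real.log T) * (zetaZeroCount T : ℝ) ≤
        simpleCriticalZeroCount T := by
  obtain ⟨c, T₀, hT₀⟩ := h
  obtain ⟨C, hCpos, hC⟩ := AH.exists_zetaZeroCount_le_mul_log
  obtain ⟨T₂, hT₂⟩ := SelbergFujii.exists_mul_log_le_zetaZeroCount
  have hC0 : 0 ≤ C := hCpos.le
  -- the base of the telescope: `T₁ ≥ T₀, e, 2`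
  set T₁ : ℝ := max T₀ (max (Real.exp 1) 2) with hT₁_def
  have hT₁0 : T₀ ≤ T₁ := le_max_left _ _
  have hT₁e : Real.exp 1 ≤ T₁ := (le_max_left _ _).trans (le_max_right _ _)
  have hT₁2 : (2 : ℝ) ≤ T₁ := (le_max_right _ _).trans (le_max_right _ _)
  have hT₁pos : 0 < T₁ := by linarith
  -- the dyadic claim with `|c|` in place of `c`
  set c₁ : ℝ := |c| with hc₁_def
  have hc₁ : 0 ≤ c₁ := abs_nonneg c
  have hstep : ∀ t : ℝ, T₁ ≤ t →
      (2 / 3 - c₁ * (Real.log (Real.log t) / Real.log t)) *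
          ((zetaZeroCount (2 * t) : ℝ) - zetaZeroCount t) ≤
        (simpleCriticalZeroCount (2 * t) : ℝ) - simpleCriticalZeroCount t := by
    intro t ht
    have h1 := hT₀ t (hT₁0.trans ht)
    have hlog := one_le_log (hT₁e.trans ht)
    have hr0 : 0 ≤ Real.log (Real.log t) / Real.log t :=
      div_nonneg (Real.log_nonneg hlog) (by linarith)
    have hN : (zetaZeroCount t : ℝ) ≤ zetaZeroCount (2 * t) := by
      exact_mod_cast zetaZeroCount_mono (by linarith)
    have hcc : c * (Real.log (Real.log t) / Real.log t) ≤ c₁ * (Real.log (Real.log t) / Real.log t) :=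
      mul_le_mul_of_nonneg_right (le_abs_self c) hr0
    have h2 : c * Real.log (Real.log t) / Real.log t = c * (Real.log (Real.log t) / Real.log t) := by
      ring
    rw [h2] at h1
    nlinarith
  have htel := telescope_rate hC0 hC hc₁ hT₁e hT₁2 hstep
  -- for every `T ≥ T₁`
  have hall : ∀ T : ℝ, T₁ ≤ T →
      2 / 3 * ((zetaZeroCount T : ℝ) - zetaZeroCount (2 * T₁)) -
          4 * C * c₁ * T * Real.log (Real.log T) ≤ simpleCriticalZeroCount T := by
    intro T hT
    obtain ⟨n, hn⟩ := pow_unbounded_of_one_lt (T / T₁) (by norm_num : (1 : ℝ) < 2)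
    refine htel n T hT ?_
    have : T / T₁ ≤ 2 ^ (n + 1) := hn.le.trans (pow_le_pow_right₀ (by norm_num) (by omega))
    rwa [div_le_iff₀ hT₁pos] at this
  -- constants
  set E : ℝ := 4 * C * c₁ with hE_def
  have hE0 : 0 ≤ E := by positivity
  set N₁ : ℝ := (zetaZeroCount (2 * T₁) : ℝ) with hN₁_def
  have hN₁0 : 0 ≤ N₁ := Nat.cast_nonneg _
  refine ⟨4 * π * (E + 1), max T₁ (max T₂ (max (Real.exp (Real.exp 1)) N₁)), fun T hT ↦ ?_⟩
  simp only [max_le_iff] at hT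
  obtain ⟨hT₁T, hT₂T, hTee, hTN⟩ := hT
  have hTe : Real.exp 1 ≤ T := le_trans (Real.exp_le_exp.2 (by linarith [Real.exp_one_gt_d9])) hTee
  have hT0 : 0 < T := (Real.exp_pos _).trans_le hTee
  have hlogT : Real.exp 1 ≤ Real.log T := by
    rw [← Real.log_exp (Real.exp 1)]
    exact Real.log_le_log (Real.exp_pos _) hTee
  have hlogT1 : 1 ≤ Real.log T := one_le_log hTe
  have hlogT0 : 0 < Real.log T := by linarith
  have hll1 : 1 ≤ Real.log (Real.log T) := one_le_log hlogT
  have hr0 : 0 ≤ Real.log (Real.log T) / Real.log T := div_nonneg (by linarith) hlogT0.le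
  have hNlow := hT₂ T hT₂T
  -- `(log log T/log T) N(T) ≥ T log log T/(4π)`
  have hkey : T * Real.log (Real.log T) / (4 * π) ≤
      Real.log (Real.log T) / Real.log T * (zetaZeroCount T : ℝ) := by
    have h1 : Real.log (Real.log T) / Real.log T * (T * Real.log T / (4 * π)) ≤
        Real.log (Real.log T) / Real.log T * (zetaZeroCount T : ℝ) :=
      mul_le_mul_of_nonneg_left hNlow hr0
    have h2 : Real.log (Real.log T) / Real.log T * (T * Real.log T / (4 * π)) =
        T * Real.log (Real.log T) / (4 * π) := by
      field_simp
    linarith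
  have hkey' : (E + 1) * (T * Real.log (Real.log T)) ≤
      4 * π * (E + 1) * (Real.log (Real.log T) / Real.log T) * (zetaZeroCount T : ℝ) := by
    have hπ : 0 < 4 * π := by positivity
    have h1 : T * Real.log (Real.log T) ≤
        4 * π * (Real.log (Real.log T) / Real.log T * (zetaZeroCount T : ℝ)) := by
      rw [div_le_iff₀ hπ] at hkey
      linarith
    have hE1 : 0 ≤ E + 1 := by linarith
    nlinarith
  -- the boundary term and the block losses are `≤ (E + 1) T log log T`
  have hTll : T ≤ T * Real.log (Real.log T) := by nlinarith
  have h23 : 2 / 3 * N₁ ≤ T * Real.log (Real.log T) := by nlinarith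
  have hmain := hall T hT₁T
  have hsplit : (2 / 3 - 4 * π * (E + 1) * Real.log (Real.log T) / Real.log T) * (zetaZeroCount T : ℝ) =
      2 / 3 * (zetaZeroCount T : ℝ) -
        4 * π * (E + 1) * (Real.log (Real.log T) / Real.log T) * (zetaZeroCount T : ℝ) := by
    ring
  rw [hsplit]
  have hEm : E * T * Real.log (Real.log T) = 4 * C * c₁ * T * Real.log (Real.log T) := by
    rw [hE_def]
  nlinarith

end Literature.NumberTheory.LFunctions
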